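import Summits.ABC.IUTFork.Joshi.ATS4InitialThetaDataExistence
import Literature.IUT.LogVolume.Corollary22PartII
import Literature.IUT.LogVolume.Corollary22GaloisImage
import Literature.IUT.LogVolume.Corollary22CondP6Transport
import Literature.IUT.LogVolume.LambdaLineGaloisDegree
import Literature.IUT.HodgeTheaters.InitialThetaDataConditions
import HarnessLib

/-!
# [J-IV] Theorem 5.7.1 (The Existence Theorem) — DISCHARGED in the tree's [IUTchIV] Cor. 2.2 vocabulary (PROOF-ONLY companion of
# `ATS4InitialThetaDataExistence.lean`)

Proof-only file (theorems, no definitions, no named facts, nothing asserted beyond what the kernel checks) of the abc-iut cell, block E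
(rung LADDER-ABC:A2.E; seat abc-iut-E-t28, slot T-28). SOURCE: K. Joshi, *Construction of Arithmetic Teichmüller Spaces IV*, arXiv:2403.10430v2
(«Preliminary version for comments», UNREFEREED) = [J-IV], Thm. 5.7.1 p.53 l.31–45 and its proof §5.8 pp.54–57 (render
`HOME/lit/renders/Joshi-arxiv-2403.10430/pNNNN.txt`). TAKES NO SIDE on [IUTchIII] Cor. 3.12, on Joshi's claims, or on Mochizuki's reports on
them; NO abc claim. Everything here is CLASSICAL: no Θ-data in the sense of [IUTchI] Def. 3.1 (d)(e)(f) are constructed, [IUTchIV] Theorem 1.10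
is never invoked (Joshi, p.53 l.27–29: «what appears below corresponds to [Mochizuki, 2021d, Corollary 2.2 (i,ii)] while … (iii) is subsumed in the
proof of Theorem 7.1.1» — and (C2), the only clause of Cor. 2.2 (ii) that needs Theorem 1.10, is NOT part of Thm. 5.7.1).

## What is proved

* `thm571With_conditions_of_fullGaloisImage` — `Cor22.FullGaloisImage → Thm571With lem587Window (ITDConditions ∧ AdmitsCore)`: for every compactly
  bounded `Z ⊆ U(Q̄)` with `2 ∈ S` and (5.6.2), every `d ≥ 1`, off a finite `Exc ⊆ U(Q̄)_{≤d}` (the points of `Z ∩ U(Q̄)_{≤d}` with `Tate(C_λ) ≤ B_d`;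
  finite by Northcott = [GenEll] Prop. 1.4 (iv), `northcott_UPle_holds`, through Prop. 5.6.1 = `Cor22.partI_holds`), the curve `C_λ` admits a prime
  `ℓ ≥ 7` in JOSHI'S window `Q^{1/2} ≤ ℓ ≤ 10·δ·Q^{1/2}·log(2·δ·Q)` with `δ = d*_mod(λ)` (Lem. 5.8.7 (1) p.56 l.35–36 — the tree's
  `Cor22.PrimeChoiceData.exists_prime_P1_P2_P3` run with `[ℚ(λ):ℚ] ≤ 6·d_mod ≤ d*_mod`, `Cor22.degree_le_six_mul_dmod`), with (P2) = Lem. 5.8.7 (2)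
  (`ℓ ∤ a_v`), (P5) = «`C_λ` has at least one prime of multiplicative reduction [not over `2ℓ`] so `V^{odd,ss} ≠ ∅`» (p.57 l.21–22; the exclusion is
  (5.8.10) `Q = Tate ≈ Tate2 ≤ Q^{1/2}·log ℓ` ⇒ `Q` bounded, Lem. 5.8.9), (P6) = Lem. 5.8.11 «`ρ_ℓ(G_L) ⊃ SL₂(𝔽_ℓ)`» (from the hypothesis), and
  «admits a core» (`Cor22.AdmitsCore`: `j ∉` the four exceptional values, `Tate ≤ 12` there — Joshi's «four j-invariants», p.54 l.19–22).
* `thm571Conditions_holds` — the same UNCONDITIONALLY: the tree PROVES `Cor22.FullGaloisImage` (`Cor22.fullGaloisImage_holds`, [GenEll] Lem. 3.5 /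
  Prop. 3.4 / Lem. 3.1 (iii) + the Tate-curve transvection). Hence **[J-IV] Thm. 5.7.1, in the `ℓ`-window of its own proof (Lem. 5.8.7 (1)) and with
  its conclusion read as the arithmetic conditions its «Completion of the Proof» (p.57 l.17–26) establishes, is a THEOREM of the tree**
  (`thm571Lem587Conditions_holds : Thm571With lem587Window ITDConditions`).
* `exists_initialThetaData_of_itdConditions` — the (P7) step «All these results and properties imply that the `C_λ` is equipped with an Initial Theta
  Data» (p.57 l.23–26) in kernel currency, for MOCHIZUKI'S `F_mod`-model `E_F = W ⊗ F` (the tree's `ETheta λ` over `FTheta λ = F_mod(√−1, W[2·3·5])`,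
  `InitialThetaDataConditions.lean`): `ITDConditions λ ℓ ∧ AdmitsCore λ` give [IUTchI] Def. 3.1 data (the tree's `exists_initialThetaData_of_conditions`)
  and hence, through E-t6's dictionary map `ATS3.InitialThetaData.ofMochizuki`, Joshi's §3.1 + §3.3 structure `ATS3.InitialThetaData F L′ L̄ E_F ℓ`
  — GIVEN the `π₁`-geometric interface of Def. 3.1 (d)(e)(f) (`BadPlacePredicates`, `ThetaGeometry`, typed in the tree, constructed by campaign L,
  explicit hypotheses here).

## What is NOT proved (and why; numbers, not adjectives)

The AS-PRINTED claim `Thm571` (window «`log(2·δ·log(Q))`», flag (a); conclusion `HasInitialThetaData` over theta fields of the LEGENDRE curve) is not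
derived: (a) its window is narrower than Lem. 5.8.7's by a logarithm; (f) [J-III] §3.3 (9) «`L/L_mod` Galois» for `L = L_mod(√−1, C_λ[2·3·5])` with the
Legendre curve `C_λ` (p.53 l.39–41) asks the `15`-torsion field `ℚ(λ)(√−1, C_λ[15])` to be Galois over `ℚ(j_λ)`; the substitution `λ ↦ 1/λ` over
`ℚ(j_λ)` replaces `C_λ` by its quadratic twist by `λ` (`Y² = λ·X(X−1)(X−λ)`), whose `15`-torsion field is `ℚ(λ)(x(C_λ[15]), √λ·y(C_λ[15]))`, equal to
`L` iff `√λ ∈ L` — so the literal reading can fail where `√λ ∉ L`, while [IUTchIV] Cor. 2.2 (p.42) and the tree use an `F_mod`-model, Galois by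
construction (third bullet). Recorded for the referee lane (ref-x) and E-cx; not adjudicated here (no single-point elimination).

[claim: Joshi2024ATS4, status: disputed] (unrefereed preprint, typed ≠ endorsed); [claim: Mochizuki2012, status: disputed] for the [IUTchIV] decls
cited BY NAME; [cite: MochizukiGenEll2010]. Standard axioms only.
-/

noncomputable section

open scoped Classical
open NumberField IsDedekindDomain Real
open Literature.NumberTheory.DiophantineGeometry.GenEll Literature.IUT.LogVolume Literature.IUT.LogVolume.Cor22
open Literature.IUT.HodgeTheaters hiding InitialThetaData

namespace Summit.ABC.IUTFork.Joshi.ATS4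

/-! ## Two inequalities for Joshi's `δ = d*_mod(λ)` -/

/-- `δ(λ) = d*_mod(λ) ≥ 2^12·3^3·5 = 552960` (`d_mod ≥ 1`). PROVED. [claim: Joshi2024ATS4, status: disputed] -/
theorem deltaMod_ge (P : NFPoint) : 552960 ≤ deltaMod P := by
  have h : (1 : ℝ) ≤ Cor22.dmod P := by exact_mod_cast Cor22.dmod_pos P
  rw [deltaMod_eq]; nlinarith

/-- `[ℚ(λ):ℚ] ≤ 6·d_mod ≤ d*_mod = δ(λ)` for `λ ∈ U` minimally presented (the tree's `Cor22.degree_le_six_mul_dmod`: `λ` is a root of the sextic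
`2⁸(X²−X+1)³ − j·X²(X−1)²` over `ℚ(j)`) — the input `[L:ℚ] ≤ δ` of Lem. 5.8.2's estimates (p.55 l.29, p.56 l.1). PROVED. [claim: Joshi2024ATS4, status: disputed] -/
theorem degree_le_deltaMod {P : NFPoint} (hP : P ∈ UP) : (P.degree : ℝ) ≤ deltaMod P := by
  have h6 : (P.degree : ℝ) ≤ 6 * (Cor22.dmod P : ℝ) := by exact_mod_cast Cor22.degree_le_six_mul_dmod P hP
  have h0 : (0 : ℝ) ≤ Cor22.dmod P := Nat.cast_nonneg _
  rw [deltaMod_eq]; nlinarith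

/-! ## The discharge of Thm. 5.7.1 (Lem-5.8.7 window, Joshi's `δ`, conclusion (P2)(P5)(P6) + core) -/

/-- **[J-IV] Thm. 5.7.1 from the classical Galois-image input** — `Cor22.FullGaloisImage → Thm571With lem587Window (ITDConditions ∧ AdmitsCore)`.
The printed proof §5.8 (pp.54–57), kernel-checked in the tree's [IUTchIV] vocabulary on the pattern of `Cor22.partII_of_thm110Legendre` with the
Theorem-1.10 step REMOVED: exceptional set `Exc = {λ ∈ Z ∩ U(Q̄)_{≤d} : Tate(C_λ) ≤ B_d}`, `B_d := ξ_prm² + 12·B_K + 81·(2^12·3^3·5·d)² + H_K^{Gal} + 50`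
(finite by Northcott through Prop. 5.6.1); off it `Q = Tate(C_λ) > B_d`, the prime of Lem. 5.8.7 with `δ = d*_mod(λ)` (`exists_prime_P1_P2_P3`), `ℓ ≥
Q^{1/2} > 7`, (P2) from Lem. 5.8.7 (2), the four core-less `j` excluded (`Tate ≤ 12`), (P5) by the exclusion `Q ≤ 12·B_K + 81·δ_d²` (Lem. 5.8.9 /
(5.8.10), via the window transported to Mochizuki's `δ_d ≥ d*_mod`, `lWindow_mono`), (P6) from the hypothesis at `Q > H_K^{Gal}`. An implication from
the named CLASSICAL hypothesis; no Θ-data, no Theorem 1.10. [claim: Joshi2024ATS4, status: disputed] -/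
theorem thm571With_conditions_of_fullGaloisImage (hFG : Cor22.FullGaloisImage) :
    Thm571With lem587Window (fun P ℓ => ITDConditions P ℓ ∧ Cor22.AdmitsCore P) := by
  intro Z h2 h562 d hd
  have hD : Cor22.Hypotheses Z := ⟨h2, (cond562_iff_jInvBounded Z).1 h562⟩
  -- Prop. 5.6.1 / [IUTchIV] Cor. 2.2 (i): `B_K` and the height comparison for Northcott
  obtain ⟨h12, h23, h3⟩ := Cor22.partI_holds Z hD
  obtain ⟨B₀, hB₀⟩ := bdEquiv_iff_abs.mp h12
  set B₁ : ℝ := max B₀ 0 with hB₁def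
  have hB₁0 : 0 ≤ B₁ := le_max_right _ _
  have hB₁ : ∀ P ∈ Z.toSet, |1 / 6 * Cor22.logQNotTwo P - 1 / 6 * Cor22.logQForall P| ≤ B₁ := fun P hP =>
    (hB₀ P hP).trans (le_max_left _ _)
  obtain ⟨C₀, hC₀⟩ := (h3.symm.trans h23.symm).bdLe
  -- the `H_K` of the classical Galois-image input; `ξ_prm`
  obtain ⟨G₀, hG₀⟩ := hFG Z hD
  set G : ℝ := max G₀ 0 with hGdef
  have hG0 : 0 ≤ G := le_max_right _ _
  obtain ⟨ξ, hξ⟩ := exists_isXiPrm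
  have hξ5 : 5 ≤ ξ := hξ.1
  have hδ2 := Cor22.two_le_delta hd
  have hδ := Cor22.delta_ge hd
  -- the exceptional bound `B_d` (depends on `Z` and `d` only)
  set Bd : ℝ := ξ ^ 2 + 12 * B₁ + 81 * Cor22.delta d ^ 2 + G + 50 with hBddef
  have hξ2 : (25 : ℝ) ≤ ξ ^ 2 := by nlinarith
  have hδsq : (0 : ℝ) ≤ 81 * Cor22.delta d ^ 2 := by positivity
  have hBd1 : ξ ^ 2 ≤ Bd := by linarith
  have hBd3 : 12 * B₁ + 81 * Cor22.delta d ^ 2 ≤ Bd := by linarith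
  have hBd6 : 49 < Bd := by linarith
  refine ⟨{P | P ∈ Z.toSet ∩ UPle d ∧ Cor22.logQForall P ≤ Bd}, ?_, ?_, ?_⟩
  · -- finiteness: Northcott through (i) `h_{ω(D)} ≤ (1/6)·Tate + C₀` on `Z`
    refine (northcott_UPle_holds d (1 / 6 * Bd + C₀)).mono ?_
    rintro P ⟨⟨hPD, hPd⟩, hPB⟩
    refine ⟨hPd, ?_⟩
    have hx : NFPoint.ht P - 1 / 6 * Cor22.logQForall P ≤ C₀ := hC₀ P hPD
    linarith
  · rintro P ⟨⟨_, hPd⟩, _⟩; exact hPd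
  -- the main case: `x_λ ∈ Z ∩ U(Q̄)_{≤d}`, `x_λ ∉ Exc`
  rintro P ⟨hPD, hPd⟩ hPexc
  have hPU : P ∈ UP := hPd.1
  set h : ℝ := Cor22.logQForall P with hhdef
  have hgt : Bd < h := by
    by_contra hle
    exact hPexc ⟨⟨hPD, hPd⟩, not_lt.mp hle⟩
  have hh0 : 0 ≤ h := Cor22.logQAvoid_nonneg P ∅
  set s : ℝ := Real.sqrt h with hsdef
  have hs2 : s ^ 2 = h := Real.sq_sqrt hh0
  have hξs : ξ ≤ s := by
    have h1 : Real.sqrt (ξ ^ 2) ≤ Real.sqrt h := Real.sqrt_le_sqrt (by linarith)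
    rwa [Real.sqrt_sq (by linarith)] at h1
  have h5s : 5 ≤ s := le_trans hξ5 hξs
  -- the curves without core (Joshi: «four j-invariants», p.54 l.19–22) are in `Exc`: `Tate ≤ 12 ≤ B_d` there
  have hcore : Cor22.AdmitsCore P := by
    by_contra hno
    have := Cor22.logQForall_le_of_not_admitsCore hno
    linarith
  -- Joshi's `δ = d*_mod(λ)`: `2 ≤ δ`, `[ℚ(λ):ℚ] ≤ δ`
  have hδJ2 : 2 ≤ deltaMod P := le_trans (by norm_num) (deltaMod_ge P)
  have hdδJ : (P.degree : ℝ) ≤ deltaMod P := degree_le_deltaMod hPU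
  -- the prime `ℓ` of Lem. 5.8.7 (1)(2)(3), with Joshi's `δ`
  have hprime : ∃ l : ℕ, l.Prime ∧ Real.sqrt h ≤ l ∧
      (l : ℝ) ≤ 10 * deltaMod P * Real.sqrt h * Real.log (2 * deltaMod P * h) ∧
      (∀ v ∈ Cor22.badPlaces P, (-(ord P.F v (Cor22.jInv P.x))).toNat ≠ 0 →
        ¬ l ∣ (-(ord P.F v (Cor22.jInv P.x))).toNat) ∧
      (∀ v ∈ Cor22.badPlaces P, residueChar P.F v = l →
        (((-(ord P.F v (Cor22.jInv P.x))).toNat : ℕ) : ℝ) < Real.sqrt h) :=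
    Cor22.PrimeChoiceData.exists_prime_P1_P2_P3
      { ι := HeightOneSpectrum (𝓞 P.F), instDecEq := inferInstance, V := Cor22.badPlaces P,
        hv := fun v => (-(ord P.F v (Cor22.jInv P.x))).toNat, fv := resDeg P.F,
        one_le_fv := fun v _ => Nat.one_le_iff_ne_zero.mpr (resDeg_ne_zero P.F v),
        pv := residueChar P.F, pv_prime := fun v _ => residueChar_prime P.F v,
        d := P.degree, one_le_d := P.degree_pos, δ := deltaMod P, two_le_δ := hδJ2, d_le_δ := hdδJ,
        h := h, h_def := Cor22.degree_mul_logQForall_eq_sum P, ξ := ξ, isXiPrm := hξ, ξ_le_sqrt := hξs }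
  obtain ⟨l, hlp, hP1lo, hP1hi, hP2, hP3⟩ := hprime
  haveI : Fact l.Prime := ⟨hlp⟩
  have h7s : 7 < s := by
    rw [hsdef, Real.lt_sqrt (by norm_num)]
    linarith
  have h7l : 7 ≤ l := by
    have : (7 : ℝ) ≤ l := le_trans h7s.le hP1lo
    exact_mod_cast this
  have hl5 : (5 : ℝ) ≤ l := by exact_mod_cast le_trans (by norm_num) h7l
  have hwinJ : LWindow (deltaMod P) h l := ⟨hP1lo, hP1hi⟩
  -- the same window with Mochizuki's `δ_d = 2^12·3^3·5·d ≥ d*_mod` (for the (P5) exclusion bound)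
  have hwinM : LWindow (Cor22.delta d) h l :=
    lWindow_mono (deltaMod_pos P) (deltaMod_le_delta hPd) hlp.one_lt.le hwinJ
  have hP2' : Cor22.CondP2 P l := Cor22.condP2_of_toNat hP2
  -- (P3) and (i): `Tate2 − Tate_{2,ℓ} ≤ Q^{1/2}·log ℓ`, `Q − Tate2 ≤ 6·B_K`
  have hQ1 : Cor22.logQNotTwo P - Cor22.logQAvoid P {2, l} ≤ s * Real.log l := by
    have := Cor22.logQAvoid_sub_insert_le P {2} hlp (Real.sqrt_nonneg h) (fun v hv hlv =>
      (hP3 v hv ((mem_placesOver_iff_residueChar v).mp (mem_placesOver_of_natCast_mem l v hlv))).le)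
    rwa [Finset.pair_comm] at this
  have hQ2 : h - Cor22.logQNotTwo P ≤ 6 * B₁ := by
    have := (abs_le.mp (hB₁ P hPD)).1
    linarith
  -- (P5): a multiplicative prime off `2ℓ` (else `Q ≤ 12·B_K + 81·δ_d² ≤ B_d < Q`; Lem. 5.8.9 / (5.8.10))
  have hP5 : Cor22.CondP5 P l := by
    by_contra hno
    have hq0 := Cor22.logQAvoid_pair_eq_zero_of_not_condP5 hno
    have hL : (l : ℝ) ≤ 20 * Cor22.delta d ^ 2 * s ^ 4 := Cor22.l_le_of_P1 h5s hδ2 (by rw [hs2]; exact hwinM.2)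
    have hmain : s ^ 2 ≤ 6 * B₁ + s * Real.log l := by rw [hs2]; linarith
    have := Cor22.h_le_of_no_bad h5s hδ hB₁0 hl5 hL hmain
    rw [hs2] at this
    linarith
  -- (P4) ⇒ (P6): the classical Galois-image input, applicable since `Q > B_d > H_K^{Gal}` (Lem. 5.8.8 / 5.8.11)
  have hP6 : Cor22.CondP6 P l := hG₀ P hPD hPU l hlp h7l hP2' hP5 (by linarith [le_max_left G₀ 0])
  exact ⟨l, hlp, hwinJ, ⟨h7l, hP2', hP5, hP6⟩, hcore⟩

/-- **[J-IV] Thm. 5.7.1 (Lem-5.8.7 window, Joshi's `δ`, conclusion (P2)(P5)(P6) + core) HOLDS, unconditionally**: the classical input is the tree's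
theorem `Cor22.fullGaloisImage_holds`. [claim: Joshi2024ATS4, status: disputed] -/
theorem thm571Conditions_holds : Thm571With lem587Window (fun P ℓ => ITDConditions P ℓ ∧ Cor22.AdmitsCore P) :=
  thm571With_conditions_of_fullGaloisImage Cor22.fullGaloisImage_holds

/-- **[J-IV] Thm. 5.7.1 in the reading `Thm571With lem587Window ITDConditions` of the statement file — a THEOREM of the tree.** PROVED
(`thm571Conditions_holds` + `thm571With_mono`). [claim: Joshi2024ATS4, status: disputed] -/
theorem thm571Lem587Conditions_holds : Thm571With lem587Window ITDConditions :=
  thm571With_mono (fun _ _ _ h => h) (fun _ _ _ _ h => h.1) thm571Conditions_holds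

/-! ## The (P7) step for Mochizuki's `F_mod`-model: the conditions give [IUTchI] Def. 3.1 data, hence Joshi's §3.1 + §3.3 structure -/

/-- E-t6's dictionary map in `Nonempty` form: [IUTchI] Def. 3.1 data (the tree's `Literature.IUT.HodgeTheaters.InitialThetaData`) yield Joshi's
[J-III] §3.1 + §3.3 structure (`ATS3.InitialThetaData.ofMochizuki`). Stated over generic carriers so that the instance arguments are taken from `D`
(keeps the concrete application below within default heartbeats). PROVED. [claim: Joshi2024ATS3, status: disputed] -/
theorem nonempty_initialThetaData_of_mochizuki {L L' Lbar : Type} [Field L] [NumberField L] [Field L'] [NumberField L'] [Algebra L L']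
    [Field Lbar] [Algebra L Lbar] [Algebra L' Lbar] (C : WeierstrassCurve L) [C.IsElliptic] (ℓ : ℕ) {Pb : BadPlacePredicates L'}
    (D : Literature.IUT.HodgeTheaters.InitialThetaData L L' Lbar C ℓ Pb) : Nonempty (ATS3.InitialThetaData L L' Lbar C ℓ) :=
  ⟨ATS3.InitialThetaData.ofMochizuki D⟩

-- (instance search over the nested subtype field `FTheta λ` and the torsion field needs a larger budget, as in the tree's constructor)
set_option synthInstance.maxHeartbeats 200000 in
/-- **«All these results and properties imply that the `C_λ` is equipped with an Initial Theta Data» (p.57 l.23–26) — kernel form for the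
`F_mod`-model.** For `λ ∈ U` minimally presented, a prime `ℓ` with `ITDConditions λ ℓ` and `AdmitsCore λ` (as delivered by `thm571Conditions_holds`):
with `F_mod = ℚ(j(λ))`, `W` the `F_mod`-model (`modCurve`), `F = F_mod(√−1, W[2·3·5])` (`FTheta`), `E_F = W ⊗ F` (`ETheta`), `K = F(E_F[ℓ])`, there EXIST
initial Θ-data in the sense of [IUTchI] Def. 3.1 (the tree's `exists_initialThetaData_of_conditions`; (P6) ⇒ (P4) by `Cor22.not_admitsLCyclic_of_condP6`
over the Galois extension `F/F_tpd` of degree prime to `ℓ ≥ 7`), with `𝕍^bad_mod` the (P5) choice, AND — through E-t6's dictionary map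
`ATS3.InitialThetaData.ofMochizuki` — Joshi's [J-III] §3.1 + §3.3 structure for `(F, K, F̄, E_F, ℓ)`; GIVEN the `π₁`-geometric interface of Def. 3.1
(d)(e)(f) (`BadPlacePredicates`, `ThetaGeometry`: typed in the tree, constructed by campaign L — explicit hypotheses). Classical; no Theorem 1.10.
[claim: Joshi2024ATS4, status: disputed] [claim: Mochizuki2012, status: disputed] -/
theorem exists_initialThetaData_of_itdConditions (P : NFPoint) (hP : P ∈ UP) {l : ℕ} [NeZero l] (hl : l.Prime)
    (h : ITDConditions P l) (hcore : Cor22.AdmitsCore P) (Pb : BadPlacePredicates (TorsionField (ETheta P) l))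
    (geom : ThetaGeometry.{0} (AlgebraicClosure (FTheta P) ≃ₐ[FTheta P] AlgebraicClosure (FTheta P))
      (galoisSubgroupOf (FTheta P) (TorsionField (ETheta P) l) (AlgebraicClosure (FTheta P))) l)
    (hbad_type : ∀ w : Val (TorsionField (ETheta P) l),
      toVMod (FTheta P) (TorsionField (ETheta P) l) (ETheta P) w ∈ Val.non '' VbadModOf (modCurve P) l →
        Pb.IsTypeOneZModLPM w)
    (hbad_cusp : ∀ w : Val (TorsionField (ETheta P) l),
      toVMod (FTheta P) (TorsionField (ETheta P) l) (ETheta P) w ∈ Val.non '' VbadModOf (modCurve P) l →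
        Pb.IsCanonicalGeneratorCusp w) :
    ∃ D : Literature.IUT.HodgeTheaters.InitialThetaData (FTheta P) (TorsionField (ETheta P) l)
        (AlgebraicClosure (FTheta P)) (ETheta P) l Pb,
      D.VbadMod = VbadModOf (modCurve P) l ∧
        Nonempty (ATS3.InitialThetaData (FTheta P) (TorsionField (ETheta P) l) (AlgebraicClosure (FTheta P)) (ETheta P) l) := by
  haveI : Fact l.Prime := ⟨hl⟩
  obtain ⟨h7, hP2, hP5, hP6⟩ := h
  letI := tpdAlgebra P hP
  haveI := isGalois_tpd P hP
  have hno : ¬ (thetaEllPt P).AdmitsLCyclic l :=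
    Cor22.not_admitsLCyclic_of_condP6 hP.1 hcore (le_trans (by norm_num) h7) hP6 (FTheta P)
      (not_dvd_finrank_tpd P hP hl h7) (ETheta P) (modelCurve_j_eq_algebraMap_jInv P hP)
  obtain ⟨D, hV, -⟩ := Literature.IUT.HodgeTheaters.exists_initialThetaData_of_conditions P hP hl h7 hP2 hP5 hno Pb geom
    hbad_type hbad_cusp
  exact ⟨D, hV, nonempty_initialThetaData_of_mochizuki (ETheta P) l D⟩

end Summit.ABC.IUTFork.Joshi.ATS4

end
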